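import Literature.NumberTheory.EllipticCurves.GreenbergVatsal2000.NonPrimitiveSelmerGroup
import Literature.NumberTheory.EllipticCurves.CyclotomicZpExtension
import Literature.NumberTheory.EllipticCurves.PAdicBSD
import Mathlib.RingTheory.PowerSeries.Binomial
import Mathlib.NumberTheory.Padics.MahlerBasis
import HarnessLib

/-!
# Greenberg–Vatsal, *On the Iwasawa invariants of elliptic curves* (Invent. Math. 142 (2000)),
# §1 pp. 8–9 and §2 Prop. (2.4): the Euler-factor elements `𝒫_ℓ(T) ∈ Λ` and the NON-PRIMITIVE
# `p`-adic `L`-function `L_{Σ₀}(E/ℚ, T) = L(E/ℚ, T) · ∏_{ℓ ∈ Σ₀} 𝒫_ℓ(T)`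
# (DEFINITIONS ONLY — every `def` has a body; nothing is asserted)

HONEST FRAMING (BSD rank-`≤ 1` residual cell `b2b-bsdres`, home
`run/shared/lean/b2b/bsd-rank1-residual/`, unit `b2b-bsdres-eisenstein-p2`, gen 17): the cell deletes
the COMBINATION-SHAPED residual classes of the rank-`≤ 1` BSD formula from PUBLISHED theorems only
and TYPES the construction-shaped ones; this is not "finishing BSD". This file only NAMES, in the
tree's vocabulary, the two objects of the ANALYTIC side of Greenberg–Vatsal's Thm. (1.5) — the
companion of `NonPrimitiveSelmerGroup.lean` (the algebraic side: `Sel^{Σ₀}_E(ℚ_∞)_p`, `s_ℓ`, `d_ℓ`,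
`δ_E^{(ℓ)} = s_ℓ d_ℓ`):

* `frobeniusExponent p x = f` — for a unit `x ∈ ℤ_pˣ`, the exponent `f ∈ ℤ_p` with
  `γ^{f} = ⟨x⟩` (`γ = γ_cyc = 1 + p^{e₀}` the tree's topological generator
  `Literature.NumberTheory.EllipticCurves.cyclotomicGenerator`, `1 + T ↔ γ`; `⟨x⟩` the projection of
  `x` to `1 + p^{e₀}ℤ_p`), i.e. the tree's normalised logarithm
  `Literature.NumberTheory.EllipticCurves.CyclotomicZp.ell` (`γ^{t·ℓ(x)} = x^t`, `t = #μ(ℤ_p)`).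
  For `x = ℓ` a prime `≠ p` this is GV's `f_ℓ`: "we replace `γ_ℓ` by `(1 + T)^{f_ℓ}`, where
  `f_ℓ ∈ ℤ_p` is determined by `γ^{f_ℓ} = γ_ℓ`" (p. 9), `γ_ℓ ∈ Γ = Gal(ℚ_∞/ℚ)` the Frobenius of `ℓ`,
  which under `Γ ≅ ℤ_pˣ/μ ≅ 1 + p^{e₀}ℤ_p` (cyclotomic character) is `⟨ℓ⟩`.
* `frobeniusSeries p ℓ = (1 + T)^{f_ℓ} ∈ Λ` — Mathlib's `PowerSeries.binomialSeries ℤ_[p] f_ℓ`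
  (the binomial ring `ℤ_p`, `Mathlib.NumberTheory.Padics.MahlerBasis`): "`γ_ℓ`" written "as a power
  series" (p. 9).
* `eulerFactorElement W p v = 𝒫_ℓ(T) = P_ℓ(E/ℚ, ℓ⁻¹ (1 + T)^{f_ℓ}) ∈ Λ` for the place `v = (ℓ)` of
  `ℚ`, where `P_ℓ(E/ℚ, X) = (1 − α_ℓ X)(1 − β_ℓ X)` is the Euler factor of `E` at `ℓ`
  (`= W.localPolynomialAt v`, Mathlib's local polynomial `1 − a_ℓ X + ℓ X²`, `1 ∓ X`, `1`; the same
  identification as in `NonPrimitiveSelmerGroup.eulerFactorModP`): "Consider the element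
  `𝒫_ℓ = (1 − α_ℓ ℓ⁻¹ γ_ℓ)(1 − β_ℓ ℓ⁻¹ γ_ℓ) ∈ ℤ_p[[Γ]]`. … We will write the element `𝒫_ℓ` of
  `ℤ_p[[Γ]]` as a power series `𝒫_ℓ(T)`" (pp. 8–9); Prop. (2.4): "Let `𝒫_ℓ = P_ℓ(ℓ⁻¹γ_ℓ) ∈ Λ`".
* `nonPrimitivePAdicLFunction W p S₀ L = L_{Σ₀}(E/ℚ, T) = L(E/ℚ, T) · ∏_{ℓ ∈ Σ₀} 𝒫_ℓ(T) ∈ ℚ_p⟦T⟧`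
  — "Thus we simply define `L_{Σ₀}(E/ℚ, T) = L(E/ℚ, T) ∏_{ℓ∈Σ₀} 𝒫_ℓ(T)`" (p. 9), for ANY candidate
  `L ∈ ℚ_p⟦T⟧` for `L(E/ℚ, T)` (the tree specifies `p`-adic `L`-functions by predicates —
  `IsPAdicLFunctionOf`, `IsSplitMultPAdicLFunctionOf`, `IsMultPAdicLFunctionOf` — so the
  non-primitive function is a function of the primitive one) and a FINITE set `Σ₀` of finite places.

The PRINTED statements about these objects — "`𝒫_ℓ(T)` is a nonzero element of `Λ` which is not
divisible by `p`" (p. 9), "Its `μ`-invariant is zero. Its `λ`-invariant is equal to `s_ℓ d_ℓ`"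
(Prop. (2.4)), hence display (9) `λ^{anal}_{E,Σ₀} = λ^{anal}_E + Σ_{ℓ∈Σ₀} δ_E^{(ℓ)}` and
"`μ^{anal}_{E,Σ₀} = μ^{anal}_E`" — are THEOREMS of the cell's Summits file
`Summits/BirchSwinnertonDyer/Rank1Residual/X2/EulerFactorInvariants.lean` (kernel proofs, no named
fact); nothing about them is asserted here.

## Citation header (read by this seat on the held text arXiv:math/9906215 =
## `paper:arxiv-math_9906215`, dvips stream decoded by the cell, `b2b-bsdres-lit/u1/gv2000_decoded.txt`
## p0031–p0032 and p0045; page numbers of the arXiv typescript)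

* GV §1 p. 8: "It is easy to modify `L(E/ℚ, T)` to construct a nonprimitive `p`-adic `L`-function.
  We want to define an element `L_{Σ₀}(E/ℚ, T) ∈ Λ ⊗ ℚ_p` by requiring that
  `L_{Σ₀}(E/ℚ, ζ − 1) = τ(χ⁻¹) α_p^{−m} L_{Σ₀}(E/ℚ, χ, 1)/Ω_E` for each nontrivial character
  `χ ∈ Hom(Γ, μ_{p^∞})` … For `ℓ ∈ Σ₀`, let `γ_ℓ` denote the Frobenius automorphism for `ℓ` in
  `Γ = Gal(ℚ_∞/ℚ)`. (Note that `ℓ` is unramified in `ℚ_∞/ℚ`, since `ℓ ≠ p`.) Consider the element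
  `𝒫_ℓ = (1 − α_ℓ ℓ⁻¹ γ_ℓ)(1 − β_ℓ ℓ⁻¹ γ_ℓ) ∈ ℤ_p[[Γ]]`."; ibid.: "`P_ℓ(E/ℚ, χ, X) =
  (1 − χ(ℓ)α_ℓ X)(1 − χ(ℓ)β_ℓ X)`, for the usual quantities `α_ℓ` and `β_ℓ`. (Possibly one or both
  of `α_l`, `β_l` are zero.)"
* GV §1 p. 9: "We will write the element `𝒫_ℓ` of `ℤ_p[[Γ]]` as a power series `𝒫_ℓ(T)`. To do
  this we replace `γ_ℓ` by `(1 + T)^{f_ℓ}`, where `f_ℓ ∈ ℤ_p` is determined by `γ^{f_ℓ} = γ_ℓ`. Since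
  `χ(γ_ℓ) = χ(ℓ)` when `χ` is viewed as a Dirichlet character, it follows that
  `𝒫_ℓ(ζ − 1) = P_ℓ(E/ℚ, χ, ℓ⁻¹)`. Thus we simply define
  `L_{Σ₀}(E/ℚ, T) = L(E/ℚ, T) ∏_{ℓ ∈ Σ₀} 𝒫_ℓ(T)`. Note that `𝒫_ℓ(T)` is a nonzero element of `Λ`
  which is not divisible by `p`. We will show later that `𝒫_ℓ(T)` generates the characteristic
  ideal of the module `𝓗_ℓ(ℚ_∞)^`. … (8) `f^{anal}_{E,Σ₀}(T) = f^{anal}_E(T) ∏_{ℓ∈Σ₀} h^{(ℓ)}_E(T)`.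
  The degree `λ^{anal}_{E,Σ₀}` of `f^{anal}_{E,Σ₀}(T)` is given by (9)
  `λ^{anal}_{E,Σ₀} = λ^{anal}_E + Σ_{ℓ∈Σ₀} δ^{(ℓ)}_E`. One can also define the `μ`-invariant
  `μ^{anal}_{E,Σ₀}` in the obvious way. One clearly has `μ^{anal}_{E,Σ₀} = μ^{anal}_E`."
* GV §2 Prop. (2.4), p. 22: "Let `P_ℓ(X) = det((1 − Frob_ℓ X)|(V_p)_{I_ℓ}) ∈ O[X]`. Let
  `𝒫_ℓ = P_ℓ(ℓ⁻¹γ_ℓ) ∈ Λ = O[[Γ]]`, where `γ_ℓ` denotes the Frobenius automorphism for `ℓ` in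
  `Γ = Gal(ℚ_∞/ℚ)`. The characteristic ideal of the `Λ`-module `𝓗_ℓ(ℚ_∞)^` is generated by `𝒫_ℓ`.
  Its `μ`-invariant is zero. Its `λ`-invariant is equal to `s_ℓ d_ℓ`." Remark: "`𝒫_l` satisfies
  an interpolation property … `χ(𝒫_l) = P_l(χ(l) l⁻¹)`, regarding `χ` as a Dirichlet character."

## Design notes (faithfulness)

* The variable. The tree's `p`-adic `L`-functions (`Literature.NumberTheory.EllipticCurves.padicLFunction`,
  MTT §I.13) are written in `1 + T ↔ γ_cyc = 1 + p^{e₀} ∈ ℤ_pˣ`: `L(T) = ∫ (1+T)^{ℓ(x)} dμ(x)` with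
  `x = η·γ_cyc^{ℓ(x)}`, `ℓ = CyclotomicZp.ell` (`PAdicLFunction.lean`, Riemann sums). Evaluating at
  `T = ζ − 1` twists by the character `x ↦ ζ^{ℓ(x)}` of `ℤ_pˣ/μ = Gal(ℚ_∞/ℚ)`, which (class field
  theory, `Frob_ℓ ↦ ℓ`) sends `γ_ℓ ↦ ζ^{ℓ(ℓ)}`; so GV's `f_ℓ` IS `CyclotomicZp.ell p ℓ` in this
  normalisation, and `𝒫_ℓ(ζ − 1) = P_ℓ(E/ℚ, ℓ⁻¹ ζ^{f_ℓ}) = P_ℓ(E/ℚ, χ, ℓ⁻¹)` as printed. Only the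
  ELEMENT `𝒫_ℓ(T) ∈ Λ` is defined here (no Galois group is mentioned); its `μ`/`λ` depend on `f_ℓ`
  only through `v_p(f_ℓ)` (`= v_p(ℓ^{p−1} − 1) − 1`, kernel theorem). See the next note for the
  ORIENTATION of `T` relative to the tree's Mazur–Tate–Teitelbaum functions.
* ORIENTATION of `T` (note added 2026-08-27, gen 163, on the by-name finding of cell `bsd-eis`,
  seat `lam-a` g5, `run/shared/lean/pub/bsd-eis/HANDOFF.md` l.1592, kits j269364 / j269773). GV's
  (3) and (8) characterise `L(E/ℚ, T)` and `L_{Σ₀}(E/ℚ, T)` by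
  `L(E/ℚ, ζ − 1) = τ(ρ⁻¹) α_p^{−m} L(E/ℚ, ρ, 1)/Ω_E` at `ζ = ρ(γ)` (p. 3 and p. 8 of the arXiv
  typescript; GV's `ρ`, written `χ` in the citation header above): the value at `ρ(γ) − 1` is the
  `ρ`-twisted `L`-value. The tree's functions (the predicates `IsPAdicLFunctionOf` /
  `IsSplitMultPAdicLFunctionOf` / `IsMultPAdicLFunctionOf`, `PAdicBSD.lean`, fact bsd.S23 after
  MTT §I.13–I.14) are characterised by
  `L(χ(γ_cyc) − 1) = ∑_{a mod p^m} χ(a) [a/p^m]⁺_f = τ(χ) L(E, χ̄, 1)/Ω⁺`: the value at `χ(γ) − 1`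
  is the `χ̄`-twisted value. Taking `χ = ρ⁻¹` shows that GV's variable is the tree's variable
  composed with the inversion automorphism `g ↦ g^ι`, `1 + T ↦ (1 + T)⁻¹`, of `Λ` (`γ ↦ γ⁻¹`;
  `T^ι = (1 + T)⁻¹ − 1` as in `PAdicLFunctionFunctionalEquationProofs.lean`, after Greenberg, LNM
  1716 §1 pp. 67–68; NOT the embedding `ι = iwasawaToPowerSeries` of the declarations below):
  `L^{GV}(T)` corresponds to `L^{tree}(T^ι)` (period and `α_p^{−m}` conventions aside; where the
  `p`-adic functional equation `subst_padicLFunction_eq_of_symmetry` applies, the two differ by its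
  unit factor `σ (1 + T)^c`). CONSEQUENCES, exactly: (i) `eulerFactorElement W p v =
  P_ℓ(ℓ⁻¹ (1 + T)^{f_ℓ})` is GV's `𝒫_ℓ` VERBATIM in GV's variable; transported to the
  tree's variable GV's depletion factor reads `𝒫_ℓ^ι = P_ℓ(ℓ⁻¹ (1 + T)^{−f_ℓ})`, whose value at
  `χ(γ) − 1` is `P_ℓ(E/ℚ, χ̄, ℓ⁻¹)`, the Euler factor of the `χ̄`-twist that the tree's `L`
  interpolates there; hence `nonPrimitivePAdicLFunction W p S₀ L` is GV's `L_{Σ₀}(E/ℚ, T)` when `L`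
  is GV-normalised, while for a TREE-normalised `L` it is `L · ∏ 𝒫_ℓ` and NOT `L^{GV}_{Σ₀}(T^ι) =
  L · ∏ 𝒫_ℓ^ι` — its value at `χ(γ) − 1` pairs the `χ̄`-twisted `L`-value with `χ`-depleted Euler
  factors, so it must not be read as interpolating `Σ₀`-depleted twisted `L`-values (the two agree
  at `T = 0`, where both give `L(0) · ∏ P_ℓ(E/ℚ, ℓ⁻¹)`). (ii) NO statement of the tree about these
  elements changes: unit content / `μ`, `λ = ord_T (· mod p)`, membership in `Λ` and congruences
  `mod pΛ` between integral elements (`X2/EulerFactorInvariants.lean`,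
  `lambdaMu_multiplicative_of_gvPar`,
  `nonPrimitive_unitContent_and_lambda_eq_residual_of_lineRamifiedEven`, the `EisensteinCongruence*`
  facts) are invariant under the `Λ`-automorphism `g ↦ g^ι` (it preserves `pΛ`, and
  `T^ι = −T(1 + T)⁻¹` is `T` times a unit, so `ord_T(g^ι mod p) = ord_T(g mod p)`), and
  `λ(L · ∏ 𝒫_ℓ) = λ(L · ∏ 𝒫_ℓ^ι) = λ^{anal}_E + Σ_{ℓ∈Σ₀} s_ℓ d_ℓ` is display (9) either way.
  (iii) Numerical witness of the orientation (EVIDENCE of cell `bsd-eis`, not a certificate): GV's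
  own congruence (10), `52a1` versus `364a1` at `p = 5`, is reproduced coefficient-wise `mod 5` up to
  `T¹²⁵` in the tree's variable with `(1 + T)^{−f_ℓ}` and fails at the coefficient of `T¹⁰` with
  `(1 + T)^{+f_ℓ}` (kit j269364, `pub/bsd-eis/STATUS.md` l.1280).
  (iv) SCOPE OF (ii) (addendum 2026-08-27, on the finding of cell `bsd-wall-p2` g7,
  `run/shared/lean/pub/bsd-wall/bsd-wall-p2/g7/V2MT-ORIENTATION-AT2-v1.3.md`, replicated by the
  census seat g10, `V2MT-FALSIFIER-RUN1-v1.md`, kit j279803): (ii) is a statement about the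
  invariants of ONE element (and congruences in which the SAME depletion product multiplies both
  sides). It does NOT cover TWO-curve congruences that pair Mazur–Tate / `p`-adic `L`-elements of two
  curves `W`, `A` (tree-oriented: value at `χ(γ) − 1` ↔ `L(f, χ̄, 1)`) each with its OWN depletion
  product over a common `Σ₀` and allow only a CONSTANT unit `u ∈ ℤ_pˣ` between the sides (the shape
  of GV's display (10), §1 p. 10 of the typescript: "`L_{Σ₀}(E₁/ℚ, T) ≡ u · L_{Σ₀}(E₂/ℚ, T) (mod p)`,
  where `u ∈ ℤ_pˣ`"): there the depletion factor must be the `ι`-oriented one,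
  `∏_{ℓ∈Σ₀} 𝒫_ℓ^ι = eulerFactorProductInv` (§4 below). At `p = 2` (`ℓ̄ = 1`, `P̄_ℓ ∈ 𝔽₂[X]`
  self-reciprocal): `𝒫̄_ℓ = ḡ_ℓ^{k_ℓ} · 𝒫̄_ℓ^ι (mod 2)` with `ḡ_ℓ = (1 + T)^{f_ℓ}` a unit and
  `k_ℓ = deg P̄_ℓ ∈ {2, 1, 0}` (good / multiplicative / additive), so the "hybrid" pairing
  (tree-oriented `θ_n` times GV-oriented `∏ 𝒫_ℓ`) differs `mod 2` from the oriented one by the unit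
  `(1 + T)^κ`, `κ = Σ_{ℓ∈Σ₀} f_ℓ (k_ℓ(W) − k_ℓ(A))`, which a constant `u` absorbs only when
  `κ ≡ 0 (mod 2^n)` at layer `n`; numerically (EVIDENCE of those cells, not a certificate) at `p = 2`,
  layers `n = 4, 6, 8`: the oriented congruences hold on 20/20 tested `W ~ A` pairs with `u ≡ 1`, the
  hybrid ones fail on 18/20 (the two survivors have `N_W = N_A`), e.g.
  `(W, A, Σ₀, n) = (19a1, 3249a1, {3, 19}, 4)`: oriented `X̄ = Ȳ`, hybrid `X̄ = x¹³ · Ȳ` in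
  `𝔽₂[x]/(x¹⁶ − 1)`.
* `frobeniusExponent` is total: `0` on non-units (junk; GV: `ℓ ≠ p`). `ℓ⁻¹ ∈ ℤ_p` is Mathlib's
  `PadicInt.inv` (junk `0` on non-units). `eulerFactorElement` at the place above `p` is junk
  (GV: "`Σ₀` … not containing `p`").
* `O = ℤ_p` throughout (elliptic curves over `ℚ`); GV's Prop. (2.4) is printed for a general
  ordinary `O`-representation `V_p` — TODO(general form): `𝒫_ℓ` for `V_p` over a finite extension
  `O/ℤ_p` and `Λ = O⟦T⟧` (not needed by the cell).

References: [GreenbergVatsal2000] §1 pp. 8–9 (displays (8)–(9)), §2 Prop. (2.4) (p. 22) and the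
Remark after it; [MazurTateTeitelbaum1986] §I.13 (the variable `T`).
-/

noncomputable section

open scoped Classical

open NumberField IsDedekindDomain WeierstrassCurve Literature.NumberTheory.EllipticCurves

namespace Literature.NumberTheory.EllipticCurves.GreenbergVatsal2000

/-! ## §1. The Frobenius exponent `f_ℓ` and `γ_ℓ = (1 + T)^{f_ℓ}` as a power series -/

section Frobenius

variable (p : ℕ) [Fact p.Prime]

/-- **`f_x ∈ ℤ_p`** for `x ∈ ℤ_p`: if `x` is a unit, the tree's normalised logarithm
`CyclotomicZp.ell p x` — the unique `f` with `γ_cyc^{t f} = x^t`, `t = #μ(ℤ_p)`, i.e. `γ_cyc^f = ⟨x⟩`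
in `1 + p^{e₀}ℤ_p`; junk `0` otherwise. For a prime `ℓ ≠ p` this is Greenberg–Vatsal's `f_ℓ`:
"`f_ℓ ∈ ℤ_p` is determined by `γ^{f_ℓ} = γ_ℓ`" (`γ_ℓ` the Frobenius of `ℓ` in `Γ = Gal(ℚ_∞/ℚ)`,
`= ⟨ℓ⟩` under the cyclotomic character; `γ ↔ 1 + T` the generator `γ_cyc` of the tree's variable).
[cite: GreenbergVatsal2000, §1 p. 9 (definition of f_ℓ)] -/
def frobeniusExponent (x : ℤ_[p]) : ℤ_[p] :=
  if h : IsUnit x then CyclotomicZp.ell p h.unit else 0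

variable {p} in
/-- On a unit, `frobeniusExponent` is `CyclotomicZp.ell` (definitional unfolding).
[cite: GreenbergVatsal2000, §1 p. 9 (definition of f_ℓ)] -/
theorem frobeniusExponent_of_isUnit {x : ℤ_[p]} (h : IsUnit x) :
    frobeniusExponent p x = CyclotomicZp.ell p h.unit := by
  rw [frobeniusExponent, dif_pos h]

variable {p} in
/-- On a non-unit, `frobeniusExponent` is the junk value `0` (definitional unfolding).
[cite: GreenbergVatsal2000, §1 p. 9 (definition of f_ℓ)] -/
theorem frobeniusExponent_of_not_isUnit {x : ℤ_[p]} (h : ¬ IsUnit x) :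
    frobeniusExponent p x = 0 := by
  rw [frobeniusExponent, dif_neg h]

/-- **`γ_ℓ` as a power series: `(1 + T)^{f_ℓ} ∈ Λ = ℤ_p⟦T⟧`** — "we replace `γ_ℓ` by
`(1 + T)^{f_ℓ}`" (GV p. 9); Mathlib's binomial series `∑ₖ (f_ℓ choose k) T^k` over the binomial ring
`ℤ_p`. [cite: GreenbergVatsal2000, §1 p. 9 (γ_ℓ = (1+T)^{f_ℓ})] -/
def frobeniusSeries (ℓ : ℕ) : IwasawaAlgebra p :=
  PowerSeries.binomialSeries ℤ_[p] (frobeniusExponent p (ℓ : ℤ_[p]))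

/-- Unfolding `frobeniusSeries` (definitional). [cite: GreenbergVatsal2000, §1 p. 9 (γ_ℓ = (1+T)^{f_ℓ})] -/
theorem frobeniusSeries_eq (ℓ : ℕ) :
    frobeniusSeries p ℓ = PowerSeries.binomialSeries ℤ_[p] (frobeniusExponent p (ℓ : ℤ_[p])) :=
  rfl

end Frobenius

/-! ## §2. The Euler-factor element `𝒫_ℓ(T) = P_ℓ(E/ℚ, ℓ⁻¹ γ_ℓ) ∈ Λ` -/

section EulerFactor

variable (W : WeierstrassCurve ℚ) (p : ℕ) [Fact p.Prime] (v : HeightOneSpectrum (𝓞 ℚ))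

/-- The point `ℓ⁻¹ γ_ℓ = ℓ⁻¹ (1 + T)^{f_ℓ} ∈ Λ` at which the Euler factor is evaluated
(`ℓ = Rat.HeightOneSpectrum.natGenerator v`; `ℓ⁻¹ = PadicInt.inv ℓ`, junk at `ℓ = p`).
[cite: GreenbergVatsal2000, §1 pp. 8–9 and §2 Prop. (2.4) (𝒫_ℓ = P_ℓ(ℓ⁻¹γ_ℓ))] -/
def eulerFactorPoint : IwasawaAlgebra p :=
  PowerSeries.C ((Rat.HeightOneSpectrum.natGenerator v : ℤ_[p]).inv) *
    frobeniusSeries p (Rat.HeightOneSpectrum.natGenerator v)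

/-- **`𝒫_ℓ(T) ∈ Λ = ℤ_p⟦T⟧`** — Greenberg–Vatsal's Euler-factor element at the finite place `v = (ℓ)`
of `ℚ`: "`𝒫_ℓ = (1 − α_ℓ ℓ⁻¹ γ_ℓ)(1 − β_ℓ ℓ⁻¹ γ_ℓ) ∈ ℤ_p[[Γ]]`" (p. 8), "`𝒫_ℓ = P_ℓ(ℓ⁻¹γ_ℓ) ∈ Λ`"
(Prop. (2.4)), written "as a power series `𝒫_ℓ(T)`" via `γ_ℓ = (1 + T)^{f_ℓ}` (p. 9); here
`P_ℓ(E/ℚ, X) = (1 − α_ℓ X)(1 − β_ℓ X) = W.localPolynomialAt v ∈ ℤ[X]` (Mathlib's local polynomial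
`1 − a_ℓ X + ℓ X²`, `1 ∓ X`, `1` by reduction type — the identification of
`NonPrimitiveSelmerGroup.eulerFactorModP`), evaluated at `X = ℓ⁻¹ (1 + T)^{f_ℓ}`. Meaningful for
`ℓ ≠ p` (GV: `p ∉ Σ₀`). [cite: GreenbergVatsal2000, §1 pp. 8–9 and §2 Prop. (2.4) (𝒫_ℓ = P_ℓ(ℓ⁻¹γ_ℓ))] -/
def eulerFactorElement : IwasawaAlgebra p :=
  Polynomial.aeval (eulerFactorPoint p v) (W.localPolynomialAt v)

/-- Unfolding `eulerFactorElement` (definitional).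
[cite: GreenbergVatsal2000, §1 pp. 8–9 and §2 Prop. (2.4) (𝒫_ℓ = P_ℓ(ℓ⁻¹γ_ℓ))] -/
theorem eulerFactorElement_eq :
    eulerFactorElement W p v =
      Polynomial.aeval
        (PowerSeries.C ((Rat.HeightOneSpectrum.natGenerator v : ℤ_[p]).inv) *
          PowerSeries.binomialSeries ℤ_[p]
            (frobeniusExponent p (Rat.HeightOneSpectrum.natGenerator v : ℤ_[p])))
        (W.localPolynomialAt v) :=
  rfl

end EulerFactor

/-! ## §3. The non-primitive `p`-adic `L`-function `L_{Σ₀}(E/ℚ, T) = L(E/ℚ, T) ∏_{ℓ∈Σ₀} 𝒫_ℓ(T)` -/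

section NonPrimitive

variable (W : WeierstrassCurve ℚ) (p : ℕ) [Fact p.Prime] (S₀ : Finset (HeightOneSpectrum (𝓞 ℚ)))

/-- **`∏_{ℓ ∈ Σ₀} 𝒫_ℓ(T) ∈ Λ`**, the product of the Euler-factor elements over the finite set `Σ₀`
of finite places (GV p. 9, the factor in the definition of `L_{Σ₀}(E/ℚ, T)`; display (8):
`f^{anal}_{E,Σ₀} = f^{anal}_E ∏ h^{(ℓ)}_E`). [cite: GreenbergVatsal2000, §1 p. 9 (definition of L_{Σ₀}(E/ℚ,T), display (8))] -/
def eulerFactorProduct : IwasawaAlgebra p :=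
  ∏ v ∈ S₀, eulerFactorElement W p v

/-- Unfolding `eulerFactorProduct` (definitional).
[cite: GreenbergVatsal2000, §1 p. 9 (definition of L_{Σ₀}(E/ℚ,T), display (8))] -/
theorem eulerFactorProduct_eq :
    eulerFactorProduct W p S₀ = ∏ v ∈ S₀, eulerFactorElement W p v :=
  rfl

/-- **The non-primitive `p`-adic `L`-function `L_{Σ₀}(E/ℚ, T) ∈ ℚ_p⟦T⟧`**: "Thus we simply define
`L_{Σ₀}(E/ℚ, T) = L(E/ℚ, T) ∏_{ℓ∈Σ₀} 𝒫_ℓ(T)`" (GV p. 9), for a candidate `L ∈ ℚ_p⟦T⟧` for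
`L(E/ℚ, T)` (specified in the tree by the predicates `IsPAdicLFunctionOf` /
`IsSplitMultPAdicLFunctionOf` / `IsMultPAdicLFunctionOf`) and a finite set `Σ₀` of finite places
not containing `p`; `ι : Λ ↪ ℚ_p⟦T⟧` is `iwasawaToPowerSeries`. ORIENTATION (module design note
«ORIENTATION of `T`», 2026-08-27): this is GV's `L_{Σ₀}` for a GV-normalised `L` (value at
`ρ(γ) − 1` = the `ρ`-twisted `L`-value, GV (3)); a tree-normalised (MTT, bsd.S23: `χ̄`-twisted value
at `χ(γ) − 1`) `L` is GV's composed with `1 + T ↦ (1 + T)⁻¹`, under which GV's depletion factor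
becomes `P_ℓ(ℓ⁻¹ (1 + T)^{−f_ℓ})`; `μ`, `λ`, integrality and congruences `mod p` are the same for
either orientation, interpolation statements are not.
[cite: GreenbergVatsal2000, §1 p. 9 (definition of L_{Σ₀}(E/ℚ,T))] -/
def nonPrimitivePAdicLFunction (L : PowerSeries ℚ_[p]) : PowerSeries ℚ_[p] :=
  L * iwasawaToPowerSeries p (eulerFactorProduct W p S₀)

/-- Unfolding `nonPrimitivePAdicLFunction` (definitional).
[cite: GreenbergVatsal2000, §1 p. 9 (definition of L_{Σ₀}(E/ℚ,T))] -/
theorem nonPrimitivePAdicLFunction_eq (L : PowerSeries ℚ_[p]) :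
    nonPrimitivePAdicLFunction W p S₀ L =
      L * iwasawaToPowerSeries p (∏ v ∈ S₀, eulerFactorElement W p v) :=
  rfl

/-- `L_{∅}(E/ℚ, T) = L(E/ℚ, T)`. [cite: GreenbergVatsal2000, §1 p. 9 (definition of L_{Σ₀}(E/ℚ,T))] -/
theorem nonPrimitivePAdicLFunction_empty (L : PowerSeries ℚ_[p]) :
    nonPrimitivePAdicLFunction W p ∅ L = L := by
  rw [nonPrimitivePAdicLFunction, eulerFactorProduct, Finset.prod_empty, map_one, mul_one]

/-- **Integral form.** If `ι b = c · L` for some `b ∈ Λ` and a constant `c ∈ ℚ_p` (the shape of the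
tree's integrality statements, e.g. `ι b = ϖ · L` in `lambdaMu_multiplicative_of_gvPar`), then
`ι (b · ∏ 𝒫_ℓ) = c · L_{Σ₀}`: the non-primitive function inherits the integral element
`b^{Σ₀} = b · ∏_{ℓ∈Σ₀} 𝒫_ℓ ∈ Λ` (GV p. 9: `𝒫_ℓ(T) ∈ Λ`, so `L_{Σ₀} ∈ Λ ⊗ ℚ_p` with `L`).
[cite: GreenbergVatsal2000, §1 p. 9 (definition of L_{Σ₀}(E/ℚ,T))] -/
theorem iwasawaToPowerSeries_mul_eulerFactorProduct {L : PowerSeries ℚ_[p]} {b : IwasawaAlgebra p}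
    {c : ℚ_[p]} (hb : iwasawaToPowerSeries p b = PowerSeries.C c * L) :
    iwasawaToPowerSeries p (b * eulerFactorProduct W p S₀) =
      PowerSeries.C c * nonPrimitivePAdicLFunction W p S₀ L := by
  rw [map_mul, hb, nonPrimitivePAdicLFunction, mul_assoc]

end NonPrimitive

/-! ## §4. The `ι`-oriented Euler-factor elements `𝒫_ℓ^ι(T) = P_ℓ(E/ℚ, ℓ⁻¹ (1 + T)^{−f_ℓ})`
## (GV's depletion factor transported to the tree's variable; module note «ORIENTATION of `T`») -/

section Oriented

variable (W : WeierstrassCurve ℚ) (p : ℕ) [Fact p.Prime]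

/-- **`(1 + T)^{−f_ℓ}` is the inverse of `γ_ℓ = (1 + T)^{f_ℓ}` in `Λ`**: Mathlib's binomial series
is additive in the exponent (`binomialSeries_add`), so `(1 + T)^{f_ℓ} · (1 + T)^{−f_ℓ} = (1 + T)^0 = 1`.
This is the algebra behind "`γ_ℓ ↦ γ_ℓ⁻¹`" under the inversion automorphism `g ↦ g^ι` of
`Λ = ℤ_p[[Γ]]` (module note «ORIENTATION of `T`»): GV's `γ_ℓ ∈ Γ` is a group element, hence a
unit of `ℤ_p[[Γ]]`, with inverse `γ_ℓ⁻¹ = (1 + T)^{−f_ℓ}`.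
[cite: GreenbergVatsal2000, §1 p. 9 (γ_ℓ = (1+T)^{f_ℓ}, f_ℓ ∈ ℤ_p with γ^{f_ℓ} = γ_ℓ)] -/
theorem frobeniusSeries_mul_binomialSeries_neg (ℓ : ℕ) :
    frobeniusSeries p ℓ *
        PowerSeries.binomialSeries ℤ_[p] (-(frobeniusExponent p (ℓ : ℤ_[p]))) = 1 := by
  rw [frobeniusSeries, ← PowerSeries.binomialSeries_add, add_neg_cancel,
    PowerSeries.binomialSeries_zero]

/-- `(1 + T)^{−f_ℓ} · (1 + T)^{f_ℓ} = 1` (the symmetric form of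
`frobeniusSeries_mul_binomialSeries_neg`).
[cite: GreenbergVatsal2000, §1 p. 9 (γ_ℓ = (1+T)^{f_ℓ}, f_ℓ ∈ ℤ_p with γ^{f_ℓ} = γ_ℓ)] -/
theorem binomialSeries_neg_mul_frobeniusSeries (ℓ : ℕ) :
    PowerSeries.binomialSeries ℤ_[p] (-(frobeniusExponent p (ℓ : ℤ_[p]))) *
        frobeniusSeries p ℓ = 1 := by
  rw [mul_comm, frobeniusSeries_mul_binomialSeries_neg]

/-- `γ_ℓ = (1 + T)^{f_ℓ}` is a unit of `Λ` (it is the image of the group element `γ_ℓ ∈ Γ` in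
`ℤ_p[[Γ]] = Λ`). [cite: GreenbergVatsal2000, §1 p. 9 (γ_ℓ = (1+T)^{f_ℓ}, f_ℓ ∈ ℤ_p with γ^{f_ℓ} = γ_ℓ)] -/
theorem isUnit_frobeniusSeries (ℓ : ℕ) : IsUnit (frobeniusSeries p ℓ) :=
  IsUnit.of_mul_eq_one _ (frobeniusSeries_mul_binomialSeries_neg p ℓ)

variable (v : HeightOneSpectrum (𝓞 ℚ))

/-- **`𝒫_ℓ^ι(T) = P_ℓ(E/ℚ, ℓ⁻¹ (1 + T)^{−f_ℓ}) ∈ Λ = ℤ_p⟦T⟧`** — the `ι`-ORIENTED Euler-factor element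
at the finite place `v = (ℓ)`: Greenberg–Vatsal's `𝒫_ℓ = P_ℓ(ℓ⁻¹ γ_ℓ)` (§1 pp. 8–9, Prop. (2.4))
with `γ_ℓ` replaced by `γ_ℓ⁻¹ = (1 + T)^{−f_ℓ}` (`frobeniusSeries_mul_binomialSeries_neg`), i.e. the
image of `eulerFactorElement W p v` under the inversion automorphism `g ↦ g^ι`, `1 + T ↦ (1 + T)⁻¹`,
of `Λ = ℤ_p[[Γ]]`. By the module note «ORIENTATION of `T`» (i) this is GV's depletion factor WRITTEN
IN THE TREE'S (Mazur–Tate–Teitelbaum) VARIABLE, in which `mazurTateElement`, `IsPollackPair`,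
`IsPAdicLFunctionOf` live (value at `χ(γ) − 1` ↔ the `χ̄`-twisted `L`-value): its value at
`χ(γ) − 1` is `P_ℓ(E/ℚ, χ̄(ℓ) ℓ⁻¹) = P_ℓ(E/ℚ, χ̄, ℓ⁻¹)` (GV Prop. (2.4) Remark: "`χ(𝒫_l) =
P_l(χ(l) l⁻¹)`", applied to `χ̄ = χ ∘ ι`), the Euler factor REMOVED from `L(E, χ̄, 1)`. Same
constant term `P_ℓ(E/ℚ, ℓ⁻¹)` as `eulerFactorElement` (`constantCoeff_eulerFactorElementInv`); same
unit content / `μ` and `λ` (note (ii); the kernel proofs are the consumers' business). Here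
`P_ℓ(E/ℚ, X) = W.localPolynomialAt v ∈ ℤ[X]`, `ℓ = Rat.HeightOneSpectrum.natGenerator v`,
`ℓ⁻¹ = PadicInt.inv ℓ` (junk at `ℓ = p`; GV: `p ∉ Σ₀`). Requested for the two-curve congruences
of note (iv) (item stmt-BirchSwinnertonDyer-20333, cell `bsd-wall-p2`).
[cite: GreenbergVatsal2000, §1 pp. 8–9 and §2 Prop. (2.4) with its Remark (𝒫_ℓ = P_ℓ(ℓ⁻¹γ_ℓ), χ(𝒫_l) = P_l(χ(l) l⁻¹)); orientation: MazurTateTeitelbaum1986 §I.13] -/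
def eulerFactorElementInv : IwasawaAlgebra p :=
  Polynomial.aeval
    (PowerSeries.C ((Rat.HeightOneSpectrum.natGenerator v : ℤ_[p]).inv) *
      PowerSeries.binomialSeries ℤ_[p]
        (-(frobeniusExponent p (Rat.HeightOneSpectrum.natGenerator v : ℤ_[p]))))
    (W.localPolynomialAt v)

/-- Unfolding `eulerFactorElementInv` (definitional).
[cite: GreenbergVatsal2000, §1 pp. 8–9 and §2 Prop. (2.4) (𝒫_ℓ = P_ℓ(ℓ⁻¹γ_ℓ))] -/
theorem eulerFactorElementInv_eq :
    eulerFactorElementInv W p v =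
      Polynomial.aeval
        (PowerSeries.C ((Rat.HeightOneSpectrum.natGenerator v : ℤ_[p]).inv) *
          PowerSeries.binomialSeries ℤ_[p]
            (-(frobeniusExponent p (Rat.HeightOneSpectrum.natGenerator v : ℤ_[p]))))
        (W.localPolynomialAt v) :=
  rfl

/-- The constant term of a `ℤ`-polynomial evaluated at `c · g(T)` with `g(0) = 1` is the polynomial
evaluated at `c`: `(P(c·g))(0) = P(c)`. [folklore] -/
private theorem constantCoeff_aeval_C_mul {R : Type*} [CommRing R] (c : R) {g : PowerSeries R}
    (hg : PowerSeries.constantCoeff g = 1) (P : Polynomial ℤ) :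
    PowerSeries.constantCoeff (Polynomial.aeval (PowerSeries.C c * g) P) =
      Polynomial.aeval c P := by
  have h : (PowerSeries.constantCoeff (R := R)).comp (algebraMap ℤ (PowerSeries R)) =
      algebraMap ℤ R :=
    RingHom.ext_int _ _
  rw [Polynomial.aeval_def, Polynomial.aeval_def, Polynomial.hom_eval₂, h, map_mul,
    PowerSeries.constantCoeff_C, hg, mul_one]

/-- **`𝒫_ℓ^ι(0) = P_ℓ(E/ℚ, ℓ⁻¹)`**: the constant term of the oriented element.
[cite: GreenbergVatsal2000, §2 Prop. (2.4) Remark (χ(𝒫_l) = P_l(χ(l) l⁻¹), trivial χ)] -/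
theorem constantCoeff_eulerFactorElementInv :
    PowerSeries.constantCoeff (eulerFactorElementInv W p v) =
      Polynomial.aeval ((Rat.HeightOneSpectrum.natGenerator v : ℤ_[p]).inv)
        (W.localPolynomialAt v) :=
  constantCoeff_aeval_C_mul _ (PowerSeries.binomialSeries_constantCoeff _) _

/-- **`𝒫_ℓ(0) = P_ℓ(E/ℚ, ℓ⁻¹)`**: the constant term of GV's element (value at the trivial character).
[cite: GreenbergVatsal2000, §2 Prop. (2.4) Remark (χ(𝒫_l) = P_l(χ(l) l⁻¹), trivial χ)] -/
theorem constantCoeff_eulerFactorElement :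
    PowerSeries.constantCoeff (eulerFactorElement W p v) =
      Polynomial.aeval ((Rat.HeightOneSpectrum.natGenerator v : ℤ_[p]).inv)
        (W.localPolynomialAt v) :=
  constantCoeff_aeval_C_mul _ (PowerSeries.binomialSeries_constantCoeff _) _

/-- The oriented and the original Euler-factor elements AGREE AT `T = 0` (module note «ORIENTATION
of `T`» (i): "the two agree at `T = 0`, where both give … `P_ℓ(E/ℚ, ℓ⁻¹)`").
[cite: GreenbergVatsal2000, §2 Prop. (2.4) Remark (χ(𝒫_l) = P_l(χ(l) l⁻¹), trivial χ)] -/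
theorem constantCoeff_eulerFactorElementInv_eq_constantCoeff_eulerFactorElement :
    PowerSeries.constantCoeff (eulerFactorElementInv W p v) =
      PowerSeries.constantCoeff (eulerFactorElement W p v) := by
  rw [constantCoeff_eulerFactorElementInv, constantCoeff_eulerFactorElement]

variable (S₀ : Finset (HeightOneSpectrum (𝓞 ℚ)))

/-- **`∏_{ℓ ∈ Σ₀} 𝒫_ℓ^ι(T) ∈ Λ`** — the `ι`-ORIENTED depletion factor
`∏_{v ∈ S₀} P_ℓ(E/ℚ, ℓ⁻¹ (1 + T)^{−f_ℓ})`: `eulerFactorProduct` with every exponent `f_ℓ` negated,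
i.e. its image under the inversion automorphism `1 + T ↦ (1 + T)⁻¹` of `Λ` — Greenberg–Vatsal's
factor `∏_{ℓ∈Σ₀} 𝒫_ℓ` of `L_{Σ₀}(E/ℚ, T)` (§1 p. 9) written in the TREE's variable (module note
«ORIENTATION of `T`» (i), (iv)): for a tree-normalised `L` (MTT §I.13; `IsPAdicLFunctionOf`,
`mazurTateElement`: value at `χ(γ) − 1` ↔ `L(f, χ̄, 1)`) the `Σ₀`-depleted element is
`L · ι(eulerFactorProductInv W p S₀)`, whose value at `χ(γ) − 1` removes exactly the Euler factors
`∏_{ℓ∈Σ₀} P_ℓ(E/ℚ, χ̄, ℓ⁻¹)` of `L(E, χ̄, 1)`; `μ`, `λ`, unit content agree with those of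
`eulerFactorProduct W p S₀` (note (ii)), interpolation and two-curve congruences with a constant
unit do not (note (iv)). [cite: GreenbergVatsal2000, §1 p. 9 (definition of L_{Σ₀}(E/ℚ,T), display (8)); orientation: MazurTateTeitelbaum1986 §I.13] -/
def eulerFactorProductInv : IwasawaAlgebra p :=
  ∏ v ∈ S₀, eulerFactorElementInv W p v

/-- Unfolding `eulerFactorProductInv` down to Mathlib primitives (definitional; this is the one-`def`
text of the request `defn-eulerFactorProductInv`).
[cite: GreenbergVatsal2000, §1 p. 9 (definition of L_{Σ₀}(E/ℚ,T), display (8))] -/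
theorem eulerFactorProductInv_eq :
    eulerFactorProductInv W p S₀ =
      ∏ v ∈ S₀, Polynomial.aeval
        (PowerSeries.C ((Rat.HeightOneSpectrum.natGenerator v : ℤ_[p]).inv) *
          PowerSeries.binomialSeries ℤ_[p]
            (-(frobeniusExponent p (Rat.HeightOneSpectrum.natGenerator v : ℤ_[p]))))
        (W.localPolynomialAt v) :=
  rfl

/-- `eulerFactorProductInv` is the product of the `eulerFactorElementInv` (definitional).
[cite: GreenbergVatsal2000, §1 p. 9 (definition of L_{Σ₀}(E/ℚ,T), display (8))] -/
theorem eulerFactorProductInv_eq_prod :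
    eulerFactorProductInv W p S₀ = ∏ v ∈ S₀, eulerFactorElementInv W p v :=
  rfl

/-- `∏_{ℓ ∈ ∅} 𝒫_ℓ^ι = 1` (so `L_{∅} = L`, as `nonPrimitivePAdicLFunction_empty`).
[cite: GreenbergVatsal2000, §1 p. 9 (definition of L_{Σ₀}(E/ℚ,T), display (8))] -/
theorem eulerFactorProductInv_empty : eulerFactorProductInv W p ∅ = 1 :=
  Finset.prod_empty

variable {S₀} in
/-- Splitting off one place: `∏_{Σ₀ ∪ {v}} 𝒫_ℓ^ι = 𝒫_v^ι · ∏_{Σ₀} 𝒫_ℓ^ι` for `v ∉ Σ₀`.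
[cite: GreenbergVatsal2000, §1 p. 9 (definition of L_{Σ₀}(E/ℚ,T), display (8))] -/
theorem eulerFactorProductInv_insert {v : HeightOneSpectrum (𝓞 ℚ)} (hv : v ∉ S₀) :
    eulerFactorProductInv W p (insert v S₀) =
      eulerFactorElementInv W p v * eulerFactorProductInv W p S₀ :=
  Finset.prod_insert hv

/-- The oriented and the original depletion factors AGREE AT `T = 0`:
`(∏ 𝒫_ℓ^ι)(0) = (∏ 𝒫_ℓ)(0) = ∏_{ℓ∈Σ₀} P_ℓ(E/ℚ, ℓ⁻¹)` (module note «ORIENTATION of `T`» (i)).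
[cite: GreenbergVatsal2000, §2 Prop. (2.4) Remark (χ(𝒫_l) = P_l(χ(l) l⁻¹), trivial χ)] -/
theorem constantCoeff_eulerFactorProductInv_eq_constantCoeff_eulerFactorProduct :
    PowerSeries.constantCoeff (eulerFactorProductInv W p S₀) =
      PowerSeries.constantCoeff (eulerFactorProduct W p S₀) := by
  rw [eulerFactorProductInv, eulerFactorProduct, map_prod, map_prod]
  exact Finset.prod_congr rfl fun v _ =>
    constantCoeff_eulerFactorElementInv_eq_constantCoeff_eulerFactorElement W p v

/-- `(∏_{ℓ∈Σ₀} 𝒫_ℓ^ι)(0) = ∏_{ℓ∈Σ₀} P_ℓ(E/ℚ, ℓ⁻¹)`.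
[cite: GreenbergVatsal2000, §2 Prop. (2.4) Remark (χ(𝒫_l) = P_l(χ(l) l⁻¹), trivial χ)] -/
theorem constantCoeff_eulerFactorProductInv :
    PowerSeries.constantCoeff (eulerFactorProductInv W p S₀) =
      ∏ v ∈ S₀, Polynomial.aeval ((Rat.HeightOneSpectrum.natGenerator v : ℤ_[p]).inv)
        (W.localPolynomialAt v) := by
  rw [eulerFactorProductInv, map_prod]
  exact Finset.prod_congr rfl fun v _ => constantCoeff_eulerFactorElementInv W p v

end Oriented

end Literature.NumberTheory.EllipticCurves.GreenbergVatsal2000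

end
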